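import Summits.NavierStokesRegularity.NavierStokesRegularity.Theorems.HubbleDynamoNoSelfExcitedDynamoStubDivCurlProfile
import Summits.NavierStokesRegularity.NavierStokesRegularity.Theorems.HubbleDynamoNoSelfExcitedDynamoStubStretchSobolev
import Summits.NavierStokesRegularity.NavierStokesRegularity.Theorems.HubbleDynamoNoSelfExcitedDynamoStubEnstrophyEvolution
import Summits.NavierStokesRegularity.NavierStokesRegularity.Theorems.HubbleDynamoNoSelfExcitedDynamoStubEnstrophyBootstrapODE
import Summits.NavierStokesRegularity.NavierStokesRegularity.Theorems.HubbleDynamoNoSelfExcitedDynamoStubRecurrentVanishingOfEnstrophyDecay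
import Summits.NavierStokesRegularity.NavierStokesRegularity.Theorems.HubbleDynamoNoSelfExcitedDynamoNoUniformlyRecurrentTypeIProfile
import Literature.Analysis.FluidPDE.SobolevWholeSpace
import HarnessLib

/-!
# Crux `NoSelfExcitedDynamo` (stmt-NavierStokesRegularity-1934), line `registered` v14/v15: the
  ENSTROPHY FLOOR of a pointwise-Type-I quasi-breather, and the small-enstrophy regime

Theorems file (lands `--supports stmt-NavierStokesRegularity-1934`; sub-goals `enstrophyFloor`,
`smallEnstrophyRegime`, and the bridges making the line's open stub G‴ equivalent to the crux). Let
`(W, Q)` be an ETERNAL classical solution of Leray's backward system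
`∂ₛW + ½W + ½(y·∇)W + (W·∇)W + ∇Q = ΔW`, `div W = 0` on `ℝ × ℝ³` (`IsBackwardLeraySolutionOn univ 1 W Q`)
in the uniform profile class `(1 + ‖y‖)^{k+1}‖DᵏW(s, y)‖ ≤ K_k`, and write, slice by slice,
`E(s) = ∫‖Ω‖²` (`Ω = curl W(s)`, the enstrophy — finite in this class, unlike in the node's
Albritton–Barker class), `D_F(s) = ∫|DΩ|²_F`, `S(s) = ∫⟪Ω, (DW)Ω⟫` (vortex stretching), and
`K_S = SNormLESNormFDerivOfEqConst ℝ³ volume 2` for Mathlib's Gagliardo–Nirenberg–Sobolev constant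
(`‖f‖₆ ≤ K_S‖Df‖₂`).

* `floor_stretch_pow_four_le`: `S⁴ ≤ K_S⁶ E³ D_F³` on every slice — the self-consistency `Ω = curl W`
  used quantitatively: `|⟪Ω,(DW)Ω⟫| ≤ ‖DW‖‖Ω‖²`, Cauchy–Schwarz twice, Sobolev for `Ω ∈ C¹ ∩ L²`
  (`stub_stretchSobolev`, p165103) and the `div`–`curl` identity `∫|DW|²_F = E`
  (`stub_divCurlProfile`, p164427).
* `smallEnstrophyRegime` (**no eternal self-excited field below the enstrophy threshold**, the
  critical, constant-free twin of the Backus regime p150871): if `K_S⁶ E(s)² ≤ ½` for ALL `s` then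
  `W ≡ 0`. For then the exact identity `E(s₁) − E(s₀) = 2∫(S − D_F − ¼E)` (`stub_enstrophyEvolution`,
  p165354) and AM–GM `S ≤ (K_S⁶E³ + 3D_F)/4` give `E(s₁) − E(s₀) ≤ −¼∫_{s₀}^{s₁}E`
  (`bootstrap_increment_le`), the backward Grönwall lemma (`stub_backwardGronwall`, p146799) kills
  the bounded `E`, and the curl-free Liouville theorem (`stub_curlFreeLiouville`, p146851) finishes.
  No recurrence is needed.
* `enstrophyFloor` (**the floor**): if `W` is moreover UNIFORMLY RECURRENT in similarity time (return
  shifts in every window `[a, a + L]`, uniformly on compacts) and `K_S⁶ E(s₀)² < ½` at ONE time, then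
  `W ≡ 0`: the bootstrap `stub_enstrophyBootstrapODE` (p165682) propagates the smallness forward and
  yields `E(s) → 0` as `s → +∞`, and `stub_recurrentVanishingOfEnstrophyDecay` (p165776) transports
  the decay back to every time along return shifts `σₙ → +∞`. Consequently a uniformly recurrent
  counterexample to the crux keeps `E(s) ≥ (2K_S⁶)^{-1/2}` at EVERY time (besides `‖W(s)‖_∞ > ε₀`,
  `sup‖W‖ ≥ 1`): the eternal, scale-free analogue of Leray's rate `‖∇u(t)‖₂ ≳ (T − t)^{-1/4}`.
* Bridges: the line's open stub G‴ ("no uniformly recurrent eternal profile-class solution ABOVE the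
  floor") is equivalent to G″ (no uniformly recurrent eternal profile-class solution at all,
  `noUniformlyRecurrentTypeIProfile_of_noRecurrentProfileAboveEnstrophyFloor` and its converse), hence
  to the crux (`noSelfExcitedDynamo_of_noRecurrentProfileAboveEnstrophyFloor`,
  `noRecurrentProfileAboveEnstrophyFloor_of_noSelfExcitedDynamo`, via p160780), and is implied by the
  node crux `RecurrentLiouville` (stmt-1589; `noRecurrentProfileAboveEnstrophyFloor_of_recurrentLiouville`).

## References

* J. Leray, *Sur le mouvement d'un liquide visqueux emplissant l'espace*, Acta Math. 63 (1934), §20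
  (lower bound on the blow-up rate of `‖∇u‖₂`). [Leray1934]
* L. C. Evans, *Partial Differential Equations*, 2nd ed. (2010), §5.6.1 (Gagliardo–Nirenberg–Sobolev).
* G. Koch, N. Nadirashvili, G. Seregin, V. Šverák, Acta Math. 203 (2009) 83–105 = arXiv:0709.3599
  (the Liouville conjecture; Lemma 3.1). [KochNadirashviliSereginSverak2009]
* Y. Pineau, V. Vicol, 2026, (3.3)–(3.4), (7.12) (enstrophy identity in similarity variables).
-/

noncomputable section

-- tree namespace `Summit.<S>.<S>.Theorems…` (summit = sub-problem), as in every Theorems file of this crux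
set_option linter.dupNamespace false

namespace Summit.NavierStokesRegularity.NavierStokesRegularity.Theorems.NoSelfExcitedDynamo.Registered

open Set MeasureTheory Filter Topology InnerProductSpace Function
open scoped RealInnerProductSpace Laplacian ContDiff NNReal ENNReal
open Literature.Analysis.FluidPDE

/-! ### The Sobolev stretching bound on every slice of an eternal profile-class flow -/

/-- **`S⁴ ≤ K_S⁶ E³ D_F³` slice by slice.** For an eternal backward-Leray flow in the uniform profile
class, at every similarity time the stretching integral `S = ∫⟪Ω,(DU)Ω⟫` is controlled by the
enstrophy `E = ∫‖Ω‖²` and the Frobenius palinstrophy `D_F = ∫|DΩ|²_F` with Mathlib's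
Gagliardo–Nirenberg–Sobolev constant and NO profile constant: `stub_stretchSobolev` (constants from
`enstrophy_decay`) followed by the `div`–`curl` identity `stub_divCurlProfile` (`div U(s) = 0`). -/
theorem floor_stretch_pow_four_le
    (U : ℝ → EuclideanSpace ℝ (Fin 3) → EuclideanSpace ℝ (Fin 3)) (P : ℝ → EuclideanSpace ℝ (Fin 3) → ℝ)
    (hL : IsBackwardLeraySolutionOn univ 1 U P)
    (hprof : ∀ k : ℕ, ∃ K : ℝ, ∀ s y, (1 + ‖y‖) ^ (k + 1) * ‖iteratedFDeriv ℝ k (U s) y‖ ≤ K) (s : ℝ) :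
    (∫ y, ⟪curl (U s) y, fderiv ℝ (U s) y (curl (U s) y)⟫) ^ 4 ≤
      ((SNormLESNormFDerivOfEqConst (EuclideanSpace ℝ (Fin 3))
          (volume : Measure (EuclideanSpace ℝ (Fin 3))) 2 : ℝ≥0) : ℝ) ^ 6 *
        (∫ y, ‖curl (U s) y‖ ^ 2) ^ 3 * (∫ y, frobeniusNormSq (fderiv ℝ (curl (U s)) y)) ^ 3 := by
  have hsm : IsSmoothSpaceTimeOn univ U := hL.smooth_velocity
  have hU3 : ∀ s, ContDiff ℝ 3 (U s) := fun s => (hsm.contDiff_slice (mem_univ s)).of_le (by norm_cast)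
  obtain ⟨K, hK0, hK⟩ := enstrophy_decay hU3 hprof
  have hU2 : ContDiff ℝ 2 (U s) := (hU3 s).of_le (by norm_cast)
  obtain ⟨-, hG⟩ := stub_divCurlProfile (U s) K hU2 (fun y => ⟨(hK s y).1, (hK s y).2.1⟩)
    (hL.divFree s (mem_univ s))
  have h2 := stub_stretchSobolev (U s) K (hU3 s) hK0 (hK s)
  rw [hG] at h2
  calc _ ≤ _ := h2
    _ = _ := by ring

/-! ### The small-enstrophy regime (no recurrence) -/

/-- **The small-enstrophy regime** (sub-goal `smallEnstrophyRegime`; the critical, constant-free twin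
of the Backus regime `stub_backusRegime`). An eternal classical solution of Leray's backward system on
`ℝ × ℝ³` in the uniform profile class whose enstrophy stays at or below the absolute threshold,
`K_S⁶ (∫‖curl U(s)‖²)² ≤ ½` for every `s`, vanishes identically: by `floor_stretch_pow_four_le`, the
evolution identity `stub_enstrophyEvolution` and AM–GM (`bootstrap_increment_le`) the bounded enstrophy
satisfies `E(s₁) − E(s₀) ≤ −¼∫_{s₀}^{s₁} E`, so the backward Grönwall lemma `stub_backwardGronwall`
gives `E ≡ 0`, the vorticity vanishes (`backusRegime_eq_zero_of_integral_sq_norm_eq_zero`) and the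
curl-free Liouville theorem `stub_curlFreeLiouville` finishes. -/
theorem smallEnstrophyRegime :
    ∀ (U : ℝ → EuclideanSpace ℝ (Fin 3) → EuclideanSpace ℝ (Fin 3)) (P : ℝ → EuclideanSpace ℝ (Fin 3) → ℝ),
      IsBackwardLeraySolutionOn univ 1 U P →
      (∀ k : ℕ, ∃ K : ℝ, ∀ s y, (1 + ‖y‖) ^ (k + 1) * ‖iteratedFDeriv ℝ k (U s) y‖ ≤ K) →
      (∀ s, ((SNormLESNormFDerivOfEqConst (EuclideanSpace ℝ (Fin 3))
          (volume : Measure (EuclideanSpace ℝ (Fin 3))) 2 : ℝ≥0) : ℝ) ^ 6 *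
        (∫ y, ‖curl (U s) y‖ ^ 2) ^ 2 ≤ 1 / 2) →
      ∀ s y, U s y = 0 := by
  intro U P hL hprof hsmall
  set KS : ℝ := ((SNormLESNormFDerivOfEqConst (EuclideanSpace ℝ (Fin 3))
      (volume : Measure (EuclideanSpace ℝ (Fin 3))) 2 : ℝ≥0) : ℝ) with hKS
  set E : ℝ → ℝ := fun s => ∫ y, ‖curl (U s) y‖ ^ 2 with hE
  set D : ℝ → ℝ := fun s => ∫ y, frobeniusNormSq (fderiv ℝ (curl (U s)) y) with hD
  set S : ℝ → ℝ := fun s => ∫ y, ⟪curl (U s) y, fderiv ℝ (U s) y (curl (U s) y)⟫ with hS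
  obtain ⟨hint, ⟨M, hM⟩, ⟨B, hB⟩, hev⟩ := stub_enstrophyEvolution U P hL hprof
  have hstretch : ∀ s, S s ^ 4 ≤ KS ^ 6 * E s ^ 3 * D s ^ 3 := floor_stretch_pow_four_le U P hL hprof
  have hE0 : ∀ s, 0 ≤ E s := fun s => integral_nonneg fun y => sq_nonneg _
  have hD0 : ∀ s, 0 ≤ D s := fun s => integral_nonneg fun y => frobeniusNormSq_nonneg _
  -- continuity of `E` from the Lipschitz bound
  have hEc : Continuous E := by
    have hL' : LipschitzWith ⟨max B 0, le_max_right _ _⟩ E :=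
      LipschitzWith.of_dist_le_mul fun s₁ s₀ => by
        rw [Real.dist_eq, Real.dist_eq]
        exact (hB s₀ s₁).trans (mul_le_mul_of_nonneg_right (le_max_left _ _) (abs_nonneg _))
    exact hL'.continuous
  -- the integral inequality `E(s₁) − E(s₀) ≤ −¼ ∫ E`
  have hincr : ∀ s₀ s₁ : ℝ, s₀ ≤ s₁ → E s₁ - E s₀ ≤ -(1 / 4) * ∫ s in s₀..s₁, E s :=
    fun s₀ s₁ h01 => bootstrap_increment_le (by positivity) hEc hE0 hD0 hstretch hev h01
      fun u _ => hsmall u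
  -- backward Grönwall: the enstrophy vanishes at every similarity time
  have hEz : ∀ s, E s = 0 := stub_backwardGronwall E (1 / 4) M (by norm_num) hE0 hM hincr
  -- hence the vorticity vanishes, and the curl-free Liouville theorem finishes
  have hcurl : ∀ s y, curl (U s) y = 0 := by
    intro s
    have hUs : ContDiff ℝ ∞ (U s) := hL.smooth_velocity.contDiff_slice (mem_univ s)
    have hΩc : Continuous (curl (U s)) := (contDiff_curl (n := 0) (hUs.of_le (by norm_cast))).continuous
    exact backusRegime_eq_zero_of_integral_sq_norm_eq_zero hΩc (hint s) (hEz s)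
  exact stub_curlFreeLiouville U P hL hprof hcurl

/-! ### The enstrophy floor of a uniformly recurrent counterexample -/

/-- **The enstrophy floor** (sub-goal `enstrophyFloor`). A UNIFORMLY RECURRENT eternal classical
solution of Leray's backward system on `ℝ × ℝ³` in the uniform profile class whose enstrophy is below
the absolute floor at ONE time, `K_S⁶ (∫‖curl W(s₀)‖²)² < ½`, vanishes identically:
`floor_stretch_pow_four_le` and `stub_enstrophyEvolution` feed the bootstrap `stub_enstrophyBootstrapODE`
(`E(s) → 0` as `s → +∞`), and `stub_recurrentVanishingOfEnstrophyDecay` transports the decay back to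
every time along return shifts `σₙ → +∞`. Equivalently: a uniformly recurrent counterexample to the crux
keeps `K_S⁶ E(s)² ≥ ½` at every similarity time `s`. -/
theorem enstrophyFloor :
    ∀ (W : ℝ → EuclideanSpace ℝ (Fin 3) → EuclideanSpace ℝ (Fin 3)) (Q : ℝ → EuclideanSpace ℝ (Fin 3) → ℝ),
      IsBackwardLeraySolutionOn univ 1 W Q →
      (∀ k : ℕ, ∃ K : ℝ, ∀ s y, (1 + ‖y‖) ^ (k + 1) * ‖iteratedFDeriv ℝ k (W s) y‖ ≤ K) →
      (∀ ε : ℝ, 0 < ε → ∀ R : ℝ, ∃ L : ℝ, 0 < L ∧ ∀ a : ℝ, ∃ σ ∈ Icc a (a + L),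
        ∀ s ∈ Icc (-R) R, ∀ y ∈ Metric.closedBall (0 : EuclideanSpace ℝ (Fin 3)) R,
          ‖W (s + σ) y - W s y‖ < ε) →
      (∃ s₀ : ℝ, ((SNormLESNormFDerivOfEqConst (EuclideanSpace ℝ (Fin 3))
          (volume : Measure (EuclideanSpace ℝ (Fin 3))) 2 : ℝ≥0) : ℝ) ^ 6 *
        (∫ y, ‖curl (W s₀) y‖ ^ 2) ^ 2 < 1 / 2) →
      ∀ s y, W s y = 0 := by
  intro W Q hW hprof hrec hsmall
  set KS : ℝ := ((SNormLESNormFDerivOfEqConst (EuclideanSpace ℝ (Fin 3))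
      (volume : Measure (EuclideanSpace ℝ (Fin 3))) 2 : ℝ≥0) : ℝ) with hKS
  set E : ℝ → ℝ := fun s => ∫ y, ‖curl (W s) y‖ ^ 2 with hE
  set D : ℝ → ℝ := fun s => ∫ y, frobeniusNormSq (fderiv ℝ (curl (W s)) y) with hD
  set S : ℝ → ℝ := fun s => ∫ y, ⟪curl (W s) y, fderiv ℝ (W s) y (curl (W s) y)⟫ with hS
  obtain ⟨s₀, hs₀⟩ := hsmall
  obtain ⟨-, ⟨M, hM⟩, ⟨B, hB⟩, hev⟩ := stub_enstrophyEvolution W Q hW hprof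
  have hstretch : ∀ s, S s ^ 4 ≤ KS ^ 6 * E s ^ 3 * D s ^ 3 := floor_stretch_pow_four_le W Q hW hprof
  have hEc : Continuous E := by
    have hL' : LipschitzWith ⟨max B 0, le_max_right _ _⟩ E :=
      LipschitzWith.of_dist_le_mul fun s₁ s₀ => by
        rw [Real.dist_eq, Real.dist_eq]
        exact (hB s₀ s₁).trans (mul_le_mul_of_nonneg_right (le_max_left _ _) (abs_nonneg _))
    exact hL'.continuous
  have hdecay : ∀ ε : ℝ, 0 < ε → ∃ T : ℝ, ∀ s, T ≤ s → E s < ε :=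
    stub_enstrophyBootstrapODE E D S (KS ^ 6) M (by positivity) hEc
      (fun s => integral_nonneg fun y => sq_nonneg _) hM
      (fun s => integral_nonneg fun y => frobeniusNormSq_nonneg _) hstretch hev s₀ hs₀
  exact stub_recurrentVanishingOfEnstrophyDecay W Q hW hprof hrec hdecay

/-! ### Bridges: the open stub G‴ (no uniformly recurrent profile above the floor) ⇔ G″ ⇔ crux -/

/-- **G‴ ⇒ G″** (sub-goal `noUniformlyRecurrentTypeIProfile_of_noRecurrentProfileAboveEnstrophyFloor`):
if every uniformly recurrent eternal profile-class solution ABOVE the enstrophy floor vanishes, then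
every uniformly recurrent eternal profile-class solution vanishes — the ones below the floor at some
time are killed by `enstrophyFloor`. -/
theorem noUniformlyRecurrentTypeIProfile_of_noRecurrentProfileAboveEnstrophyFloor
    (hG3 : ∀ (W : ℝ → EuclideanSpace ℝ (Fin 3) → EuclideanSpace ℝ (Fin 3)) (Q : ℝ → EuclideanSpace ℝ (Fin 3) → ℝ),
      IsBackwardLeraySolutionOn univ 1 W Q →
      (∀ k : ℕ, ∃ K : ℝ, ∀ s y, (1 + ‖y‖) ^ (k + 1) * ‖iteratedFDeriv ℝ k (W s) y‖ ≤ K) →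
      (∀ ε : ℝ, 0 < ε → ∀ R : ℝ, ∃ L : ℝ, 0 < L ∧ ∀ a : ℝ, ∃ σ ∈ Icc a (a + L),
        ∀ s ∈ Icc (-R) R, ∀ y ∈ Metric.closedBall (0 : EuclideanSpace ℝ (Fin 3)) R,
          ‖W (s + σ) y - W s y‖ < ε) →
      (∀ s, 1 / 2 ≤ ((SNormLESNormFDerivOfEqConst (EuclideanSpace ℝ (Fin 3))
            (volume : Measure (EuclideanSpace ℝ (Fin 3))) 2 : ℝ≥0) : ℝ) ^ 6 *
          (∫ y, ‖curl (W s) y‖ ^ 2) ^ 2) →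
      ∀ s y, W s y = 0) :
    ∀ (W : ℝ → EuclideanSpace ℝ (Fin 3) → EuclideanSpace ℝ (Fin 3)) (Q : ℝ → EuclideanSpace ℝ (Fin 3) → ℝ),
      IsBackwardLeraySolutionOn univ 1 W Q →
      (∀ k : ℕ, ∃ K : ℝ, ∀ s y, (1 + ‖y‖) ^ (k + 1) * ‖iteratedFDeriv ℝ k (W s) y‖ ≤ K) →
      (∀ ε : ℝ, 0 < ε → ∀ R : ℝ, ∃ L : ℝ, 0 < L ∧ ∀ a : ℝ, ∃ σ ∈ Icc a (a + L),
        ∀ s ∈ Icc (-R) R, ∀ y ∈ Metric.closedBall (0 : EuclideanSpace ℝ (Fin 3)) R,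
          ‖W (s + σ) y - W s y‖ < ε) →
      ∀ s y, W s y = 0 := by
  intro W Q hW hprof hrec
  by_cases h : ∃ s₀ : ℝ, ((SNormLESNormFDerivOfEqConst (EuclideanSpace ℝ (Fin 3))
            (volume : Measure (EuclideanSpace ℝ (Fin 3))) 2 : ℝ≥0) : ℝ) ^ 6 *
          (∫ y, ‖curl (W s₀) y‖ ^ 2) ^ 2 < 1 / 2
  · exact enstrophyFloor W Q hW hprof hrec h
  · push Not at h
    exact hG3 W Q hW hprof hrec h

/-- **G″ ⇒ G‴** (trivial direction: G‴ has one hypothesis more). -/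
theorem noRecurrentProfileAboveEnstrophyFloor_of_noUniformlyRecurrentTypeIProfile
    (hG : ∀ (W : ℝ → EuclideanSpace ℝ (Fin 3) → EuclideanSpace ℝ (Fin 3)) (Q : ℝ → EuclideanSpace ℝ (Fin 3) → ℝ),
      IsBackwardLeraySolutionOn univ 1 W Q →
      (∀ k : ℕ, ∃ K : ℝ, ∀ s y, (1 + ‖y‖) ^ (k + 1) * ‖iteratedFDeriv ℝ k (W s) y‖ ≤ K) →
      (∀ ε : ℝ, 0 < ε → ∀ R : ℝ, ∃ L : ℝ, 0 < L ∧ ∀ a : ℝ, ∃ σ ∈ Icc a (a + L),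
        ∀ s ∈ Icc (-R) R, ∀ y ∈ Metric.closedBall (0 : EuclideanSpace ℝ (Fin 3)) R,
          ‖W (s + σ) y - W s y‖ < ε) →
      ∀ s y, W s y = 0) :
    ∀ (W : ℝ → EuclideanSpace ℝ (Fin 3) → EuclideanSpace ℝ (Fin 3)) (Q : ℝ → EuclideanSpace ℝ (Fin 3) → ℝ),
      IsBackwardLeraySolutionOn univ 1 W Q →
      (∀ k : ℕ, ∃ K : ℝ, ∀ s y, (1 + ‖y‖) ^ (k + 1) * ‖iteratedFDeriv ℝ k (W s) y‖ ≤ K) →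
      (∀ ε : ℝ, 0 < ε → ∀ R : ℝ, ∃ L : ℝ, 0 < L ∧ ∀ a : ℝ, ∃ σ ∈ Icc a (a + L),
        ∀ s ∈ Icc (-R) R, ∀ y ∈ Metric.closedBall (0 : EuclideanSpace ℝ (Fin 3)) R,
          ‖W (s + σ) y - W s y‖ < ε) →
      (∀ s, 1 / 2 ≤ ((SNormLESNormFDerivOfEqConst (EuclideanSpace ℝ (Fin 3))
            (volume : Measure (EuclideanSpace ℝ (Fin 3))) 2 : ℝ≥0) : ℝ) ^ 6 *
          (∫ y, ‖curl (W s) y‖ ^ 2) ^ 2) →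
      ∀ s y, W s y = 0 :=
  fun W Q hW hprof hrec _ => hG W Q hW hprof hrec

/-- **G‴ ⇒ crux** (sub-goal `noSelfExcitedDynamo_of_noRecurrentProfileAboveEnstrophyFloor`; the
conclusion is the crux `NoSelfExcitedDynamo` unfolded): through G″
(`noUniformlyRecurrentTypeIProfile_of_noRecurrentProfileAboveEnstrophyFloor`) and the landed
`noSelfExcitedDynamo_of_noUniformlyRecurrentTypeIProfile` (p160780). -/
theorem noSelfExcitedDynamo_of_noRecurrentProfileAboveEnstrophyFloor
    (hG3 : ∀ (W : ℝ → EuclideanSpace ℝ (Fin 3) → EuclideanSpace ℝ (Fin 3)) (Q : ℝ → EuclideanSpace ℝ (Fin 3) → ℝ),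
      IsBackwardLeraySolutionOn univ 1 W Q →
      (∀ k : ℕ, ∃ K : ℝ, ∀ s y, (1 + ‖y‖) ^ (k + 1) * ‖iteratedFDeriv ℝ k (W s) y‖ ≤ K) →
      (∀ ε : ℝ, 0 < ε → ∀ R : ℝ, ∃ L : ℝ, 0 < L ∧ ∀ a : ℝ, ∃ σ ∈ Icc a (a + L),
        ∀ s ∈ Icc (-R) R, ∀ y ∈ Metric.closedBall (0 : EuclideanSpace ℝ (Fin 3)) R,
          ‖W (s + σ) y - W s y‖ < ε) →
      (∀ s, 1 / 2 ≤ ((SNormLESNormFDerivOfEqConst (EuclideanSpace ℝ (Fin 3))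
            (volume : Measure (EuclideanSpace ℝ (Fin 3))) 2 : ℝ≥0) : ℝ) ^ 6 *
          (∫ y, ‖curl (W s) y‖ ^ 2) ^ 2) →
      ∀ s y, W s y = 0) :
    ∀ u : ℝ → EuclideanSpace ℝ (Fin 3) → EuclideanSpace ℝ (Fin 3),
      IsBoundedAncientMildSolution 1 u →
      (∀ t < 0, AEStronglyMeasurable (u t) volume) → (∃ C : ℝ, HasTypeIDecay C u) →
      ∀ t < 0, u t =ᵐ[volume] (0 : EuclideanSpace ℝ (Fin 3) → EuclideanSpace ℝ (Fin 3)) :=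
  noSelfExcitedDynamo_of_noUniformlyRecurrentTypeIProfile
    (noUniformlyRecurrentTypeIProfile_of_noRecurrentProfileAboveEnstrophyFloor hG3)

/-- **crux ⇒ G‴** (sub-goal `noRecurrentProfileAboveEnstrophyFloor_of_noSelfExcitedDynamo`; hypothesis
= the crux unfolded): through the landed `noUniformlyRecurrentTypeIProfile_of_noSelfExcitedDynamo`
(p160780). So G‴ ⇔ G″ ⇔ crux. -/
theorem noRecurrentProfileAboveEnstrophyFloor_of_noSelfExcitedDynamo :
    (∀ u : ℝ → EuclideanSpace ℝ (Fin 3) → EuclideanSpace ℝ (Fin 3),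
      IsBoundedAncientMildSolution 1 u →
      (∀ t < 0, AEStronglyMeasurable (u t) volume) → (∃ C : ℝ, HasTypeIDecay C u) →
      ∀ t < 0, u t =ᵐ[volume] (0 : EuclideanSpace ℝ (Fin 3) → EuclideanSpace ℝ (Fin 3))) →
    ∀ (W : ℝ → EuclideanSpace ℝ (Fin 3) → EuclideanSpace ℝ (Fin 3)) (Q : ℝ → EuclideanSpace ℝ (Fin 3) → ℝ),
      IsBackwardLeraySolutionOn univ 1 W Q →
      (∀ k : ℕ, ∃ K : ℝ, ∀ s y, (1 + ‖y‖) ^ (k + 1) * ‖iteratedFDeriv ℝ k (W s) y‖ ≤ K) →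
      (∀ ε : ℝ, 0 < ε → ∀ R : ℝ, ∃ L : ℝ, 0 < L ∧ ∀ a : ℝ, ∃ σ ∈ Icc a (a + L),
        ∀ s ∈ Icc (-R) R, ∀ y ∈ Metric.closedBall (0 : EuclideanSpace ℝ (Fin 3)) R,
          ‖W (s + σ) y - W s y‖ < ε) →
      (∀ s, 1 / 2 ≤ ((SNormLESNormFDerivOfEqConst (EuclideanSpace ℝ (Fin 3))
            (volume : Measure (EuclideanSpace ℝ (Fin 3))) 2 : ℝ≥0) : ℝ) ^ 6 *
          (∫ y, ‖curl (W s) y‖ ^ 2) ^ 2) →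
      ∀ s y, W s y = 0 :=
  fun hcrux => noRecurrentProfileAboveEnstrophyFloor_of_noUniformlyRecurrentTypeIProfile
    (noUniformlyRecurrentTypeIProfile_of_noSelfExcitedDynamo hcrux)

/-- **node ⇒ G‴** (sub-goal `noRecurrentProfileAboveEnstrophyFloor_of_recurrentLiouville`): the node
crux `RecurrentLiouville` (stmt-NavierStokesRegularity-1589, six-route Type-I Liouville node) implies
the line's open stub, through the crux (p157812, p160780). -/
theorem noRecurrentProfileAboveEnstrophyFloor_of_recurrentLiouville (h : Theses.SqueezeCycle.RecurrentLiouville) :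
    ∀ (W : ℝ → EuclideanSpace ℝ (Fin 3) → EuclideanSpace ℝ (Fin 3)) (Q : ℝ → EuclideanSpace ℝ (Fin 3) → ℝ),
      IsBackwardLeraySolutionOn univ 1 W Q →
      (∀ k : ℕ, ∃ K : ℝ, ∀ s y, (1 + ‖y‖) ^ (k + 1) * ‖iteratedFDeriv ℝ k (W s) y‖ ≤ K) →
      (∀ ε : ℝ, 0 < ε → ∀ R : ℝ, ∃ L : ℝ, 0 < L ∧ ∀ a : ℝ, ∃ σ ∈ Icc a (a + L),
        ∀ s ∈ Icc (-R) R, ∀ y ∈ Metric.closedBall (0 : EuclideanSpace ℝ (Fin 3)) R,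
          ‖W (s + σ) y - W s y‖ < ε) →
      (∀ s, 1 / 2 ≤ ((SNormLESNormFDerivOfEqConst (EuclideanSpace ℝ (Fin 3))
            (volume : Measure (EuclideanSpace ℝ (Fin 3))) 2 : ℝ≥0) : ℝ) ^ 6 *
          (∫ y, ‖curl (W s) y‖ ^ 2) ^ 2) →
      ∀ s y, W s y = 0 :=
  noRecurrentProfileAboveEnstrophyFloor_of_noUniformlyRecurrentTypeIProfile
    (noUniformlyRecurrentTypeIProfile_of_recurrentLiouville h)

end Summit.NavierStokesRegularity.NavierStokesRegularity.Theorems.NoSelfExcitedDynamo.Registered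

end
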